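import Mathlib

/-!
# Crux `HilbertIntegralOverconvergentIsCongruence` (stmt-Langlands-8485), line `Sketch-ideate-r1-k1`:
# the graded gain (glue between the `d`-free lever and the transcendence endgame)

In the Arakelov-free assembly the lever (`stub_katzSturmAbstract`: vanishing on a lower set
`D ⊇ W` ⇒ `‖G_n‖ ≤ C ρ^{M+1}`) is applied to auxiliary functions `F_P` whose Katz data live in the
GRADED family of classical expansions: `a_i ∈ V (w + i t)` with `t` the weight of the Hasse lift
`e ∈ V t`, `V a · V b ⊆ V (a + b)`, each `V k` satisfying the sup-norm Sturm principle on a window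
`W k` lying strictly below a Sturm LINE `L k` for a monotone weight `wt` on exponents.  This file proves
the resulting GAIN in the shape the endgame (`stub_auxLinearForms`) consumes: if `F` vanishes in all
weights `< m` and `L (w + M t) ≤ m` then `‖F_n‖ ≤ C ρ^{M+1}` for every exponent `n` — the truncation
`Σ_{i ≤ M} a_i e^{M-i}` lies in `V (w + M t)` by the grading, `{wt < m}` is a lower set, and
`W (w + M t) ⊆ {wt < m}`.  The lever enters as the hypothesis `hLever` (verbatim the registered statement
of `stub_katzSturmAbstract` at this `K, σ`, LANDED in `…KatzSturmAbstract.lean`; discharged by it in the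
assembly).  Theorems only, no `sorry`.
-/

set_option linter.dupNamespace false

noncomputable section

namespace Summit.Langlands.Langlands.Theorems.HilbertIntegralOverconvergentIsCongruence

open MvPowerSeries in
/-- **Graded gain (registered stub `stub_gradedKatzGain`).**  Over a nonarchimedean normed field `K`
in any set of variables `σ`, assume the `d`-free lever (`hLever`).  Let `V : ℤ → Set` be a graded
family (`1 ∈ V 0`, `V a · V b ⊆ V (a+b)`, each `V a` closed under finite sums) with the sup-norm Sturm
principle on windows `W k` strictly below a Sturm line `L k` for a monotone weight `wt`; `e ∈ V t` an
integral Hasse lift with constant term `1`; `a_i ∈ V (w + i t)` a Katz datum with `‖(a_i)_n‖ ≤ C ρ^i`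
(`0 ≤ ρ ≤ 1`, `0 ≤ C`) summing to `G` along `e⁻¹`.  If `G_n = 0` whenever `wt n < m`, and
`L (w + M t) ≤ m`, then `‖G_n‖ ≤ C ρ^{M+1}` for every `n`. [folklore] -/
theorem stub_gradedKatzGain {K σ : Type*} [NormedField K] [IsUltrametricDist K]
    (hLever : ∀ (V : Set (MvPowerSeries σ K)) (W : Set (σ →₀ ℕ)),
      (∀ T ∈ V, ∀ B : ℝ, 0 ≤ B → (∀ n ∈ W, ‖coeff n T‖ ≤ B) → ∀ n, ‖coeff n T‖ ≤ B) →
      ∀ (e : MvPowerSeries σ K), constantCoeff e = 1 → (∀ n, ‖coeff n e‖ ≤ 1) →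
      ∀ (a : ℕ → MvPowerSeries σ K) (ρ C : ℝ), 0 ≤ ρ → ρ ≤ 1 → 0 ≤ C →
      (∀ i n, ‖coeff n (a i)‖ ≤ C * ρ ^ i) →
      ∀ (M : ℕ), (∑ i ∈ Finset.range (M + 1), a i * e ^ (M - i)) ∈ V →
      ∀ (G : MvPowerSeries σ K),
      (∀ n, HasSum (fun i : ℕ ↦ coeff n (a i * e⁻¹ ^ i)) (coeff n G)) →
      ∀ (D : Set (σ →₀ ℕ)), IsLowerSet D → (∀ n ∈ D, coeff n G = 0) → W ⊆ D →
      ∀ n, ‖coeff n G‖ ≤ C * ρ ^ (M + 1))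
    (V : ℤ → Set (MvPowerSeries σ K)) (hV1 : (1 : MvPowerSeries σ K) ∈ V 0)
    (hVmul : ∀ (b₁ b₂ : ℤ) (φ ψ : MvPowerSeries σ K), φ ∈ V b₁ → ψ ∈ V b₂ → φ * ψ ∈ V (b₁ + b₂))
    (hVsum : ∀ (b : ℤ) (s : Finset ℕ) (φ : ℕ → MvPowerSeries σ K),
      (∀ i ∈ s, φ i ∈ V b) → (∑ i ∈ s, φ i) ∈ V b)
    (W : ℤ → Set (σ →₀ ℕ))
    (hSturm : ∀ (k : ℤ), ∀ T ∈ V k, ∀ B : ℝ, 0 ≤ B → (∀ n ∈ W k, ‖coeff n T‖ ≤ B) →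
      ∀ n, ‖coeff n T‖ ≤ B)
    (wt : (σ →₀ ℕ) → ℕ) (hwt : Monotone wt) (L : ℤ → ℕ) (hWL : ∀ k, ∀ n ∈ W k, wt n < L k)
    (e : MvPowerSeries σ K) (t : ℤ) (he0 : constantCoeff e = 1) (he : ∀ n, ‖coeff n e‖ ≤ 1)
    (heV : e ∈ V t)
    (a : ℕ → MvPowerSeries σ K) (w : ℤ) (haV : ∀ i : ℕ, a i ∈ V (w + i * t))
    (ρ C : ℝ) (hρ : 0 ≤ ρ) (hρ1 : ρ ≤ 1) (hC : 0 ≤ C) (ha : ∀ i n, ‖coeff n (a i)‖ ≤ C * ρ ^ i)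
    (G : MvPowerSeries σ K) (hG : ∀ n, HasSum (fun i : ℕ ↦ coeff n (a i * e⁻¹ ^ i)) (coeff n G))
    (m : ℕ) (hvan : ∀ n, wt n < m → coeff n G = 0) (M : ℕ) (hM : L (w + M * t) ≤ m) :
    ∀ n, ‖coeff n G‖ ≤ C * ρ ^ (M + 1) := by
  -- powers of the Hasse lift are graded: `e^k ∈ V (k t)`
  have hepow : ∀ k : ℕ, e ^ k ∈ V (k * t) := by
    intro k
    induction k with
    | zero => simpa using hV1
    | succ k ih =>
        have := hVmul _ _ _ _ ih heV
        rw [← pow_succ] at this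
        convert this using 2
        push_cast
        ring
  -- the truncation is classical of weight `w + M t`
  have htrunc : (∑ i ∈ Finset.range (M + 1), a i * e ^ (M - i)) ∈ V (w + M * t) := by
    refine hVsum _ _ _ fun i hi ↦ ?_
    have hiM : i ≤ M := Nat.lt_succ_iff.mp (Finset.mem_range.mp hi)
    have := hVmul _ _ _ _ (haV i) (hepow (M - i))
    convert this using 2
    rw [Nat.cast_sub hiM]
    ring
  -- `{wt < m}` is a lower set containing the window of weight `w + M t`
  have hlower : IsLowerSet {n : σ →₀ ℕ | wt n < m} := fun n n' hle hn ↦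
    lt_of_le_of_lt (hwt hle) hn
  have hWD : W (w + M * t) ⊆ {n : σ →₀ ℕ | wt n < m} := fun n hn ↦
    lt_of_lt_of_le (hWL _ n hn) hM
  exact hLever (V (w + M * t)) (W (w + M * t)) (hSturm _) e he0 he a ρ C hρ hρ1 hC ha M htrunc G hG
    {n | wt n < m} hlower (fun n hn ↦ hvan n hn) hWD

end Summit.Langlands.Langlands.Theorems.HilbertIntegralOverconvergentIsCongruence

end
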